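import Summits.SmoothPoincare4.SmoothPoincare4.Theses.SblfDescent
import Summits.SmoothPoincare4.SmoothPoincare4.Theorems.SblfDescentStepTwoReduction
import Summits.SmoothPoincare4.SmoothPoincare4.Theorems.SblfDescentSblfExistsShield

/-!
# fwd-ladder seed g4-SmoothPoincare4-18530 — the ladder of `SblfDescent.SblfExists` (Sketch)

Top C = `SblfDescent.SblfExists` (every smooth homotopy 4-sphere carries a simplified broken
Lefschetz fibration of SOME lower genus `h`; a published theorem, Baykur–Saeki 2017 Cor. 6.2,
equivalent to the summit only modulo the parent route's descent cruxes).  The gradation parameter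
in C's own language is the LOWER GENUS `h` (⇔ `4h` Lefschetz points on a homotopy sphere).  Two
graded families are typed here:

* `GenusRecognition h` — "a smooth homotopy 4-sphere carrying an SBLF of lower genus `h` is
  diffeomorphic to `S⁴`".  Floor `h = 0` ⟺ the parent's `RungOne` (Hayano 2011 Cor. 4.11,
  Baykur–Kamada 2015 Lemma 11; `genusRecognition_zero_iff_rungOne`).  Rung `h = 1`
  (`GenusTwoRecognition`) is VERBATIM the registered apex `stub_genusTwoRecognition` of
  `Cruxes/StepTwo/Lines/Sketch.lean` and ⟺ the parent crux `StepTwo` modulo two published facts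
  (`genusTwoRecognition_iff_stepTwo`, from p153819) — i.e. the next rung is ALREADY FILED.
* `BrokenGenusLe n` — the uniform variant "every smooth homotopy 4-sphere has broken genus ≤ n+1".
  `BrokenGenusLe n → SblfExists` for every `n` (top = `n → ∞`), `SmoothPoincare4 → BrokenGenusLe n`
  (on path), and `GenusTwoRecognition → BrokenGenusLe 1 → SmoothPoincare4` modulo Hayano's fact
  (`smoothPoincare4_of_genusTwoRecognition_of_brokenGenusLeOne`) — an honest two-crux `closes`,
  NOT opened (critic: no attack on a uniform complexity bound for homotopy spheres).
-/

set_option linter.dupNamespace false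

namespace Summit.SmoothPoincare4.SmoothPoincare4.Fwd.SblfExistsLadder

open scoped Manifold ContDiff Topology ContinuousMap
open Literature.Topology.FourManifolds
open Summit.SmoothPoincare4.SmoothPoincare4.Theses
open Summit.SmoothPoincare4.SmoothPoincare4.Theorems

/-- Graded family, parameter = lower genus `h`: **genus-`(h+1)` recognition on homotopy 4-spheres** —
every smooth `X ≃ₕ S⁴` carrying a simplified broken Lefschetz fibration of lower genus `h` (higher
genus `h+1`, `4h` Lefschetz points) is diffeomorphic to `S⁴`. -/
def GenusRecognition (h : ℕ) : Prop :=
  ∀ (X : Type) [TopologicalSpace X] [T2Space X] [SecondCountableTopology X]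
    [ChartedSpace (EuclideanSpace ℝ (Fin 4)) X] [IsManifold (𝓡 4) ((⊤ : ℕ∞) : WithTop ℕ∞) X],
    X ≃ₕ Metric.sphere (0 : EuclideanSpace ℝ (Fin 5)) 1 →
    (∃ (o : SmoothOrientation (𝓡 4) X) (f : X → Metric.sphere (0 : EuclideanSpace ℝ (Fin 3)) 1)
        (L : Finset X), IsSimplifiedBrokenLefschetzFibration o f L h) →
    Nonempty (Diffeomorph (𝓡 4) (𝓡 4) X (Metric.sphere (0 : EuclideanSpace ℝ (Fin 5)) 1)
      ((⊤ : ℕ∞) : WithTop ℕ∞))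

/-- Candidate rung R1 (`h = 1`): **genus-two recognition** — homotopy 4-spheres of broken genus `≤ 2`
are standard.  (= apex stub of the parent's crux `StepTwo`; open in print, Baykur–Saeki 2018 §6.) -/
def GenusTwoRecognition : Prop := GenusRecognition 1

/-- Graded family, parameter = genus bound `n`: **uniform broken-genus bound** — every smooth homotopy
4-sphere carries a simplified broken Lefschetz fibration of lower genus `≤ n`. `n → ∞` is the top
`SblfExists`. -/
def BrokenGenusLe (n : ℕ) : Prop :=
  ∀ (X : Type) [TopologicalSpace X] [T2Space X] [SecondCountableTopology X]
    [ChartedSpace (EuclideanSpace ℝ (Fin 4)) X] [IsManifold (𝓡 4) ((⊤ : ℕ∞) : WithTop ℕ∞) X],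
    X ≃ₕ Metric.sphere (0 : EuclideanSpace ℝ (Fin 5)) 1 →
    ∃ h ≤ n, ∃ (o : SmoothOrientation (𝓡 4) X) (f : X → Metric.sphere (0 : EuclideanSpace ℝ (Fin 3)) 1)
        (L : Finset X), IsSimplifiedBrokenLefschetzFibration o f L h

/-- Candidate rung R2 (`n = 1`): every smooth homotopy 4-sphere has broken genus `≤ 2`. -/
def BrokenGenusLeOne : Prop := BrokenGenusLe 1

/-! ## The floor: `GenusRecognition 0` is the parent's `RungOne` (pure repackaging). -/

theorem genusRecognition_zero_iff_rungOne : GenusRecognition 0 ↔ SblfDescent.RungOne := by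
  constructor
  · intro H M _ _ _ _ _ e hM
    obtain ⟨o, f, L, h1, h2, h3, h4, h5, h6, h7, h8, h9, h10⟩ := hM
    exact H M e ⟨o, f, L, ⟨h1, h2, h3, h4, h5, h6, h7, h8, h9, h10⟩⟩
  · intro h1 X _ _ _ _ _ e hX
    obtain ⟨o, f, L, ⟨g1, g2, g3, g4, g5, g6, g7, g8, g9, g10⟩⟩ := hX
    exact h1 X e ⟨o, f, L, g1, g2, g3, g4, g5, g6, g7, g8, g9, g10⟩

/-- F3 `_special` witness: the floor `h = 0` of the family holds, GIVEN Hayano's published genus-one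
classification (named fact `nonempty_diffeomorph_sphere_four_of_sblf_genus_one`, Hayano 2011 Cor. 4.11 /
Baykur–Kamada 2015 Lemma 11), via the landed `RungOne_of_sblfGenusOne`. -/
theorem genusRecognition_special
    (hH : nonempty_diffeomorph_sphere_four_of_sblf_genus_one) : GenusRecognition 0 :=
  genusRecognition_zero_iff_rungOne.mpr (RungOne_of_sblfGenusOne hH)

/-! ## The rung `h = 1` is the parent's crux `StepTwo` (covered). -/

/-- `GenusTwoRecognition ↔ StepTwo` modulo ADK's genus-one fibration of `S⁴` and Hayano's genus-one
classification — this is `stepTwo_iff_genusTwoRecognition` (p153819) read backwards: the candidate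
rung is the registered apex of `Cruxes/StepTwo/Lines/Sketch.lean`, not a new statement. -/
theorem genusTwoRecognition_iff_stepTwo
    (hADK : exists_sblf_genus_one_noLefschetz_sphere_four)
    (hH : nonempty_diffeomorph_sphere_four_of_sblf_genus_one) :
    GenusTwoRecognition ↔ SblfDescent.StepTwo :=
  (stepTwo_iff_genusTwoRecognition hADK hH).symm

/-! ## On-path lemmas (F4): `S → Rung v` for every `v`. -/

/-- `SmoothPoincare4 → GenusRecognition h` for every `h` (ignore the fibration). -/
theorem genusRecognition_onpath (hS : _root_.SmoothPoincare4) (h : ℕ) : GenusRecognition h := by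
  intro X _ _ _ _ _ e _
  exact hS X ‹_› ‹_› e

/-- `SmoothPoincare4 → BrokenGenusLe n` for every `n`, unconditionally: under the summit `X ≅ S⁴`
carries the transported ADK fibration of lower genus `0` (`exists_sblf_zero_of_diffeomorph_sphere_four`). -/
theorem brokenGenusLe_onpath (hS : _root_.SmoothPoincare4) (n : ℕ) : BrokenGenusLe n := by
  intro X _ _ _ _ _ e
  obtain ⟨Φ⟩ := hS X ‹_› ‹_› e
  obtain ⟨o, f, hf⟩ := exists_sblf_zero_of_diffeomorph_sphere_four X Φ
  exact ⟨0, Nat.zero_le n, o, f, ∅, hf⟩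

/-- `SmoothPoincare4 → BrokenGenusLeOne` (the rung R2 at its parameter value, by name). -/
theorem brokenGenusLeOne_onpath (hS : _root_.SmoothPoincare4) : BrokenGenusLeOne :=
  brokenGenusLe_onpath hS 1

/-- `SmoothPoincare4 → GenusTwoRecognition` (the rung R1 at its parameter value, by name). -/
theorem genusTwoRecognition_onpath (hS : _root_.SmoothPoincare4) : GenusTwoRecognition :=
  genusRecognition_onpath hS 1

/-! ## Lattice position of the uniform family. -/

theorem brokenGenusLe_mono {m n : ℕ} (hmn : m ≤ n) : BrokenGenusLe m → BrokenGenusLe n := by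
  intro H X _ _ _ _ _ e
  obtain ⟨h, hh, o, f, L, hf⟩ := H X e
  exact ⟨h, hh.trans hmn, o, f, L, hf⟩

/-- Every rung of the uniform family implies the top `SblfExists` (so `BrokenGenusLe n` can never be a
LINE under the support item `SblfExists`: it is strictly harder than the published theorem). -/
theorem sblfExists_of_brokenGenusLe (n : ℕ) (H : BrokenGenusLe n) : SblfDescent.SblfExists := by
  refine sblfExists_iff.mpr ?_
  intro M _ _ _ _ _ e
  obtain ⟨h, -, o, f, L, hf⟩ := H M e
  exact ⟨o, f, L, h, hf⟩

/-- The honest two-crux `closes` of the would-be route (NOT opened): genus-two recognition plus the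
uniform bound `BrokenGenusLe 1` decide the summit, GIVEN Hayano's genus-one classification. -/
theorem smoothPoincare4_of_genusTwoRecognition_of_brokenGenusLeOne
    (hH : nonempty_diffeomorph_sphere_four_of_sblf_genus_one)
    (hR : GenusTwoRecognition) (hU : BrokenGenusLeOne) : _root_.SmoothPoincare4 := by
  intro X _ _ _ _ _ e
  obtain ⟨h, hh, o, f, L, hf⟩ := hU X e
  interval_cases h
  · exact genusRecognition_special hH X e ⟨o, f, L, hf⟩
  · exact hR X e ⟨o, f, L, hf⟩

end Summit.SmoothPoincare4.SmoothPoincare4.Fwd.SblfExistsLadder
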